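import Mathlib.Analysis.Calculus.ContDiff.Bounds
import Mathlib.Analysis.Calculus.IteratedDeriv.Lemmas
import Mathlib.Topology.Algebra.Module.FiniteDimension
import HarnessLib

/-!
# Bounds on `iteratedFDeriv` from bounds on basis tuples ∕ nested directional derivatives (finite-dimensional source)
# (Hörmander ALPDO I §1.1: a `C^∞` function all of whose partial derivatives are bounded has bounded Fréchet jets)

Topic `Analysis/Calculus`; namespace `Literature.Analysis.Calculus`.  THEOREMS ONLY (no `def`, no instance, no axiom, no `sorry`).  Generic multivariable calculus, written for the
transport of one-variable jet bounds (Casimir ladders in the normal coordinate of a wall) to the `iteratedFDeriv`-bounds of Bouaziz's (I₂) (cell `pub/hodgecm-mathlib`, crux H413, line LH3,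
organ O-L3′ (ii), stage (α4) of LH3-p01 (g4)'s plan; count-neutral): the analytic engines bound PURE derivatives along ONE direction of a family of functions closed under the other
directional derivatives, and (I₂) asks for `‖iteratedFDeriv ℝ n Ψ c‖`.
* §1 **`exists_norm_le_pow_mul_sum_norm_apply_basis`** — for a basis `b` of a finite-dimensional real normed space `V` there is `C ≥ 0` with, for EVERY `n` and every continuous `n`-linear
  `A : V^n → F`, `‖A‖ ≤ Cⁿ · Σ_{I : Fin n → ι} ‖A (b ∘ I)‖` (expand each argument in the basis; the coordinates are bounded by `C ‖v‖`).
* §2 **`exists_forall_norm_iteratedFDeriv_apply_basis_le_of_closed`** ∕ **`exists_forall_norm_iteratedFDeriv_le_of_closed`** — THE FAMILY PRINCIPLE: if a set `𝓘` of functions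
  `C^∞` on an open `U` is closed, up to equality on `U`, under the directional derivatives `y ↦ Dg(y)·b i` along the basis vectors, and every member is BOUNDED on a set `A ⊆ U`
  (order `0` only), then every member has ALL its jets `iteratedFDeriv ℝ n g` bounded on `A` (`iteratedFDeriv ℝ (n+1) g x (b∘I) = iteratedFDeriv ℝ n (y ↦ Dg(y)·b i_last) x (b ∘ init I)`
  on `U`, Mathlib `iteratedFDerivWithin_succ_apply_right` + `iteratedFDerivWithin_clm_apply_const_apply`, then §1).
* §3 **`iteratedDirDeriv_eq_iteratedDeriv_lineRestrict`** — the `a`-fold nested directional derivative along a FIXED vector `v` is the `a`-th one-variable derivative of the restriction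
  to the line: `(D_v^a g)(x + t v) = iteratedDeriv a (s ↦ g (x + s • v)) t` for `t` in an open `J` with `x + J·v ⊆ U` — the bridge from one-variable jet bounds (`iteratedDeriv`) to the order-`0`
  bounds of the members `D_v^a g` of such a family.
HONEST LABEL: generic calculus; HC_CM is proved only modulo the 7 printed citations (2 remaining: hLiu418 = stmt-HodgeConjecture-24832, h413 = stmt-HodgeConjecture-24833) until rung 0 closes.

## References
* [HormanderALPDO1] L. Hörmander, *The Analysis of Linear Partial Differential Operators I*, 2nd ed. (1990), §1.1 pp. 7–12 (Thms. 1.1.6–1.1.9).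
-/

set_option autoImplicit false

noncomputable section

open Set Filter Topology Function
open scoped ContDiff

namespace Literature.Analysis.Calculus

/-! ## §1 A continuous multilinear map on a finite-dimensional space is bounded by its values on basis tuples -/

section Multilinear

variable {ι : Type*} [Fintype ι] {V : Type*} [NormedAddCommGroup V] [NormedSpace ℝ V] {F : Type*} [NormedAddCommGroup F] [NormedSpace ℝ F]

/-- **`‖A‖ ≤ Cⁿ · Σ_I ‖A(b ∘ I)‖` for every continuous `n`-linear map `A`, with `C = ‖b.equivFunL‖` depending only on the basis `b`**: expand each argument in the basis (Mathlib
`MultilinearMap.map_sum`, `map_smul_univ`); each coordinate is bounded by `C · ‖v‖`. [cite: HormanderALPDO1, §1.1 pp. 7–12] -/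
theorem exists_norm_le_pow_mul_sum_norm_apply_basis (b : Module.Basis ι ℝ V) :
    ∃ C : ℝ, 0 ≤ C ∧ ∀ (n : ℕ) (A : ContinuousMultilinearMap ℝ (fun _ : Fin n => V) F), ‖A‖ ≤ C ^ n * ∑ I : Fin n → ι, ‖A fun k => b (I k)‖ := by
  classical
  refine ⟨‖(b.equivFunL : V →L[ℝ] ι → ℝ)‖, norm_nonneg _, fun n A => ?_⟩
  -- the coordinates are bounded by `C ‖v‖`
  have hcoord : ∀ (v : V) (i : ι), |b.repr v i| ≤ ‖(b.equivFunL : V →L[ℝ] ι → ℝ)‖ * ‖v‖ := by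
    intro v i
    have h1 : |b.repr v i| ≤ ‖(b.equivFunL : V →L[ℝ] ι → ℝ) v‖ := by
      have h := norm_le_pi_norm ((b.equivFunL : V →L[ℝ] ι → ℝ) v) i
      rw [Real.norm_eq_abs] at h
      convert h using 2
      simp [Module.Basis.equivFunL_apply]
    exact h1.trans ((b.equivFunL : V →L[ℝ] ι → ℝ).le_opNorm v)
  refine ContinuousMultilinearMap.opNorm_le_bound (by positivity) fun m => ?_
  -- expand every argument in the basis
  have hexp : A m = ∑ I : Fin n → ι, (∏ k, b.repr (m k) (I k)) • A fun k => b (I k) := by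
    have hm : m = fun k => ∑ i, b.repr (m k) i • b i := funext fun k => (b.sum_repr (m k)).symm
    conv_lhs => rw [hm]
    rw [A.map_sum (fun k i => b.repr (m k) i • b i)]
    exact Finset.sum_congr rfl fun I _ => A.map_smul_univ (fun k => b.repr (m k) (I k)) fun k => b (I k)
  rw [hexp]
  calc ‖∑ I : Fin n → ι, (∏ k, b.repr (m k) (I k)) • A fun k => b (I k)‖
      ≤ ∑ I : Fin n → ι, ‖(∏ k, b.repr (m k) (I k)) • A fun k => b (I k)‖ := norm_sum_le _ _
    _ = ∑ I : Fin n → ι, (∏ k, |b.repr (m k) (I k)|) * ‖A fun k => b (I k)‖ := by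
        refine Finset.sum_congr rfl fun I _ => ?_
        rw [norm_smul, Real.norm_eq_abs, Finset.abs_prod]
    _ ≤ ∑ I : Fin n → ι, (∏ k, ‖(b.equivFunL : V →L[ℝ] ι → ℝ)‖ * ‖m k‖) * ‖A fun k => b (I k)‖ := by
        refine Finset.sum_le_sum fun I _ => mul_le_mul_of_nonneg_right ?_ (norm_nonneg _)
        exact Finset.prod_le_prod (fun k _ => abs_nonneg _) fun k _ => hcoord (m k) (I k)
    _ = ‖(b.equivFunL : V →L[ℝ] ι → ℝ)‖ ^ n * (∑ I : Fin n → ι, ‖A fun k => b (I k)‖) * ∏ k, ‖m k‖ := by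
        rw [Finset.prod_mul_distrib, Finset.prod_const, Finset.card_univ, Fintype.card_fin, ← Finset.mul_sum]
        ring

end Multilinear

/-! ## §2 THE FAMILY PRINCIPLE: order-`0` bounds for a family closed under directional derivatives give bounds on all jets -/

section Family

variable {ι : Type*} [Fintype ι] {V : Type*} [NormedAddCommGroup V] [NormedSpace ℝ V] {F : Type*} [NormedAddCommGroup F] [NormedSpace ℝ F]

omit [Fintype ι] in
/-- **Jets on basis tuples of a directionally closed family are bounded**: if every `g ∈ 𝓘` is `C^∞` on the open `U`, `𝓘` is closed up to equality on `U` under `y ↦ Dg(y)·(b i)` for the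
basis vectors `b i`, and every member is bounded on `A ⊆ U`, then for every `n`, `g ∈ 𝓘` and `I : Fin n → ι`, `x ↦ iteratedFDeriv ℝ n g x (b ∘ I)` is bounded on `A` (induction on `n`:
`∂^{n+1} g (b∘I) = ∂ⁿ (Dg·b i_last) (b ∘ init I)` on `U`). [cite: HormanderALPDO1, §1.1 pp. 7–12] -/
theorem exists_forall_norm_iteratedFDeriv_apply_basis_le_of_closed (b : Module.Basis ι ℝ V) {U : Set V} (hU : IsOpen U) {A : Set V} (hAU : A ⊆ U)
    (𝓘 : Set (V → F)) (hsmooth : ∀ g ∈ 𝓘, ContDiffOn ℝ ∞ g U) (hcl : ∀ g ∈ 𝓘, ∀ i, ∃ g' ∈ 𝓘, EqOn (fun y => fderiv ℝ g y (b i)) g' U)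
    (hbd : ∀ g ∈ 𝓘, ∃ B : ℝ, ∀ x ∈ A, ‖g x‖ ≤ B) :
    ∀ (n : ℕ) (g : V → F), g ∈ 𝓘 → ∀ I : Fin n → ι, ∃ B : ℝ, ∀ x ∈ A, ‖iteratedFDeriv ℝ n g x (fun k => b (I k))‖ ≤ B := by
  -- the `iteratedFDerivWithin` version on `U`, by induction on `n` (as ★ `iteratedFDerivWithin_apply_basis_eq_zero'`)
  have key : ∀ (n : ℕ) (g : V → F), g ∈ 𝓘 → ∀ I : Fin n → ι, ∃ B : ℝ, ∀ x ∈ A, ‖iteratedFDerivWithin ℝ n g U x (fun k => b (I k))‖ ≤ B := by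
    intro n
    induction n with
    | zero =>
      intro g hg I
      obtain ⟨B, hB⟩ := hbd g hg
      exact ⟨B, fun x hx => by rw [iteratedFDerivWithin_zero_apply]; exact hB x hx⟩
    | succ n ih =>
      intro g hg I
      obtain ⟨g', hg', hgg'⟩ := hcl g hg (I (Fin.last n))
      obtain ⟨B, hB⟩ := ih g' hg' fun k => I (Fin.castSucc k)
      refine ⟨B, fun x hx => ?_⟩
      have hxU : x ∈ U := hAU hx
      have hc : ContDiffOn ℝ ∞ (fun y => fderivWithin ℝ g U y) U := (hsmooth g hg).fderivWithin hU.uniqueDiffOn (by simp)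
      have happly := iteratedFDerivWithin_clm_apply_const_apply (𝕜 := ℝ) hU.uniqueDiffOn hc (i := n) (by exact_mod_cast le_top) hxU
        (u := b (I (Fin.last n))) (m := Fin.init fun k => b (I k))
      have heq : EqOn (fun y => fderivWithin ℝ g U y (b (I (Fin.last n)))) g' U := fun y hy => by
        rw [← hgg' hy]
        show fderivWithin ℝ g U y (b (I (Fin.last n))) = fderiv ℝ g y (b (I (Fin.last n)))
        rw [fderivWithin_of_isOpen hU hy]
      rw [iteratedFDerivWithin_succ_apply_right hU.uniqueDiffOn hxU, ← happly, iteratedFDerivWithin_congr heq hxU]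
      exact hB x hx
  intro n g hg I
  obtain ⟨B, hB⟩ := key n g hg I
  exact ⟨B, fun x hx => by rw [← iteratedFDerivWithin_of_isOpen n hU (hAU hx)]; exact hB x hx⟩

/-- **THE FAMILY PRINCIPLE**: under the hypotheses of ★ `exists_forall_norm_iteratedFDeriv_apply_basis_le_of_closed` (every `g ∈ 𝓘` is `C^∞` on the open `U`; `𝓘` is closed up to
equality on `U` under the directional derivatives along a basis; every member is bounded on `A ⊆ U`), EVERY JET of every member is bounded on `A`:
`∀ n, ∃ B, ∀ x ∈ A, ‖iteratedFDeriv ℝ n g x‖ ≤ B` (§1). [cite: HormanderALPDO1, §1.1 pp. 7–12] -/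
theorem exists_forall_norm_iteratedFDeriv_le_of_closed (b : Module.Basis ι ℝ V) {U : Set V} (hU : IsOpen U) {A : Set V} (hAU : A ⊆ U)
    (𝓘 : Set (V → F)) (hsmooth : ∀ g ∈ 𝓘, ContDiffOn ℝ ∞ g U) (hcl : ∀ g ∈ 𝓘, ∀ i, ∃ g' ∈ 𝓘, EqOn (fun y => fderiv ℝ g y (b i)) g' U)
    (hbd : ∀ g ∈ 𝓘, ∃ B : ℝ, ∀ x ∈ A, ‖g x‖ ≤ B) {g : V → F} (hg : g ∈ 𝓘) (n : ℕ) :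
    ∃ B : ℝ, ∀ x ∈ A, ‖iteratedFDeriv ℝ n g x‖ ≤ B := by
  classical
  obtain ⟨C, hC0, hC⟩ := exists_norm_le_pow_mul_sum_norm_apply_basis (F := F) b
  choose B hB using fun I : Fin n → ι => exists_forall_norm_iteratedFDeriv_apply_basis_le_of_closed b hU hAU 𝓘 hsmooth hcl hbd n g hg I
  refine ⟨C ^ n * ∑ I : Fin n → ι, B I, fun x hx => (hC n (iteratedFDeriv ℝ n g x)).trans ?_⟩
  exact mul_le_mul_of_nonneg_left (Finset.sum_le_sum fun I _ => hB I x hx) (pow_nonneg hC0 n)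

/-- **Bounded image form** of the family principle: `BddAbove ((‖iteratedFDeriv ℝ n g ·‖) '' A)`. [cite: HormanderALPDO1, §1.1 pp. 7–12] -/
theorem bddAbove_norm_iteratedFDeriv_image_of_closed (b : Module.Basis ι ℝ V) {U : Set V} (hU : IsOpen U) {A : Set V} (hAU : A ⊆ U)
    (𝓘 : Set (V → F)) (hsmooth : ∀ g ∈ 𝓘, ContDiffOn ℝ ∞ g U) (hcl : ∀ g ∈ 𝓘, ∀ i, ∃ g' ∈ 𝓘, EqOn (fun y => fderiv ℝ g y (b i)) g' U)
    (hbd : ∀ g ∈ 𝓘, ∃ B : ℝ, ∀ x ∈ A, ‖g x‖ ≤ B) {g : V → F} (hg : g ∈ 𝓘) (n : ℕ) :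
    BddAbove ((fun x => ‖iteratedFDeriv ℝ n g x‖) '' A) := by
  obtain ⟨B, hB⟩ := exists_forall_norm_iteratedFDeriv_le_of_closed b hU hAU 𝓘 hsmooth hcl hbd hg n
  exact ⟨B, forall_mem_image.2 hB⟩

end Family

/-! ## §3 Nested directional derivatives along one vector are the one-variable derivatives of the restriction to the line -/

section Line

variable {V : Type*} [NormedAddCommGroup V] [NormedSpace ℝ V] {F : Type*} [NormedAddCommGroup F] [NormedSpace ℝ F]

/-- **`(D_v^a g)(x + t v) = (d/dt)^a [g(x + t v)]`** while the segment stays in the open set `U` on which `g` is `C^∞`: the `a`-fold nested directional derivative `D_v g = y ↦ Dg(y)·v`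
along a FIXED vector is the `a`-th derivative of the restriction to the line.  (The members `D_v^a g` of a directionally closed family are read off the one-variable jets.)
[cite: HormanderALPDO1, §1.1 pp. 7–12] -/
theorem iteratedDirDeriv_eq_iteratedDeriv_lineRestrict {U : Set V} (hU : IsOpen U) (x v : V) {J : Set ℝ} (hJ : IsOpen J) (hJU : ∀ t ∈ J, x + t • v ∈ U) (a : ℕ) :
    ∀ {g : V → F}, ContDiffOn ℝ ∞ g U → ∀ t ∈ J, ((fun h : V → F => fun y => fderiv ℝ h y v)^[a] g) (x + t • v) = iteratedDeriv a (fun s => g (x + s • v)) t := by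
  induction a with
  | zero => intro g _ t _; simp
  | succ a ih =>
    intro g hg t ht
    -- `D_v g` is again `C^∞` on `U`, and on `J` it is the derivative of the restriction of `g` to the line
    have hDg : ContDiffOn ℝ ∞ (fun y => fderiv ℝ g y v) U := by
      have h := ((hg.fderivWithin hU.uniqueDiffOn (m := ∞) (by simp)).clm_apply contDiffOn_const : ContDiffOn ℝ ∞ (fun y => fderivWithin ℝ g U y v) U)
      exact h.congr fun y hy => by simp only [fderivWithin_of_isOpen hU hy]
    have hline : ∀ s ∈ J, deriv (fun s => g (x + s • v)) s = fderiv ℝ g (x + s • v) v := by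
      intro s hs
      have hgd : HasFDerivAt g (fderiv ℝ g (x + s • v)) (x + s • v) :=
        (((hg.differentiableOn (by simp)).differentiableAt (hU.mem_nhds (hJU s hs))).hasFDerivAt)
      have hl : HasDerivAt (fun s : ℝ => x + s • v) v s := by
        simpa using ((hasDerivAt_id s).smul_const v).const_add x
      exact (hgd.comp_hasDerivAt s hl).deriv
    rw [Function.iterate_succ_apply, ih hDg t ht, iteratedDeriv_succ']
    -- the two inner functions agree near `t`
    refine Filter.EventuallyEq.iteratedDeriv_eq a ?_
    filter_upwards [hJ.mem_nhds ht] with s hs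
    exact (hline s hs).symm

end Line

end Literature.Analysis.Calculus

end
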